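import Mathlib.Algebra.Order.Archimedean.Real.Basic
import Mathlib.Algebra.Order.Floor.Ring
import Mathlib.Tactic
import Literature.Computability.Cryptography.InfrastructureNavigation
import Literature.Computability.Complexity.CodeFPArith
import Literature.Computability.Complexity.CodeFPBudgets
import HarnessLib

/-!
# The infrastructure walk on integers, in polynomial time

Topic `Computability/Cryptography`; sequel of `InfrastructureNavigation.lean` (`WalkData`: the
programs `start`, `dbl`, `descent`, `final`, `table` of Jozsa 2003, Thm. 5, on rational states):
their fixed-point integer versions, the exact correspondence, and their implementation in the typed
polynomial-time algebra `CodeFP` (`Complexity/CodeFP*.lean`) from polynomial-time primitives.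
Theorem-and-definition file, no named facts.

A machine does not compute with rationals of unbounded shape; in Hallgren's algorithm every
computed distance is a multiple of `2⁻ᵖ` (the evaluators of `CodeFPLog.lean` return integers
`≈ 2ᵖ ln γ`). This file re-runs the walk on INTEGER states `(a, D̂)` meaning `(a, D̂/2ᵖ)`:

* `IntWalkOps δ ι` — a family, indexed by the instance `d : δ` (the discriminant), of unit ideals,
  baby/giant steps and integer evaluators `gInt`, `kInt` with a precision `prec d = p` and an integer
  defect bound `KInt`; `IntWalkOps.toWalkData d` is the `WalkData` with `ghat = gInt/2ᵖ`,
  `khat = kInt/2ᵖ`, `K = KInt/2ᵖ`;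
* the integer programs `babyI`, `giantI`, `startI`, `dblI`, `descentFromI`, `finalI`, `tableI`
  (targets `x = v/N` compared through `D̂ · N ≤ v · 2ᵖ`, the offset through an integer ceiling
  division), and
* **the correspondence** `cast_startI`, `cast_dblI`, `cast_descentFromI`, `cast_finalI`,
  **`tableI_eq_table`**: dividing the integer distance by `2ᵖ` gives exactly the rational walk of
  `InfrastructureNavigation.lean`, so all its theorems (`table_blur`, `table_exact`, canonicity)
  transfer to the integer table the machine computes;
* **polynomial time** (`IntWalkOps.FPSpec`: a validity predicate on labels — the reduced ideals —
  closed under the steps, with label/evaluator codes polynomially bounded in the instance code, and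
  `CodeFP` hypotheses for `unit`, `rho`, `star`, `gInt`, `kInt`, `KInt`, `prec`): `codeFP_startI`,
  `codeFP_dblI`, `codeFP_descentI` (rounds `descRound` over a unit budget that RECOMPUTE their level,
  so that every fold runs on genuine, valid states — `O(T²)` giant steps), `codeFP_finalI` and
  **`codeFP_tableI`**: `(d, N, v, 1^{s₀}, 1^T, 1^B) ↦ tableI d N s₀ T B v` is computed on codes by a
  polynomial-time string function (Jozsa 2003, Prop. 36 (ii): "h̃_N(k) is computable in
  poly(log k, log N, log d) time"), the accumulator bounds coming from `|D̂| ≤ (T 2ᵀ(s₀+1) + B) 2^{B(d)}`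
  on valid states (`valid_descentFromI`, `valid_iterate_finStepI`).

## References

* R. Jozsa, *Notes on Hallgren's efficient quantum algorithm for solving Pell's equation*,
  arXiv:quant-ph/0302134 (2003), §9 Thm. 5 ("arithmetic operations with integers of size O(N) …
  can be performed in poly(log N) time"). [Jozsa2003]
-/

noncomputable section

namespace Literature.Computability.Cryptography

open WalkData

/-- **Integer walk operations**, indexed by the instance: unit ideal, baby step, giant step, integer
gap and defect evaluators at precision `prec`, and an integer defect bound.
[cite: Jozsa2003, §9 Thm. 5] -/
structure IntWalkOps (δ ι : Type) where
  /-- the unit ideal of instance `d` -/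
  unit : δ → ι
  /-- baby step -/
  rho : δ → ι → ι
  /-- giant step -/
  star : δ → ι → ι → ι
  /-- `gInt d a ≈ 2ᵖ ·` (gap after `a`) -/
  gInt : δ → ι → ℤ
  /-- `kInt d a b ≈ 2ᵖ ·` (defect of `a * b`) -/
  kInt : δ → ι → ι → ℤ
  /-- `KInt d / 2ᵖ` bounds the defects -/
  KInt : δ → ℕ
  /-- the precision `p` -/
  prec : δ → ℕ

namespace IntWalkOps

variable {δ ι : Type} (O : IntWalkOps δ ι) (d : δ)

/-- The rational walk data of instance `d`: evaluators divided by `2ᵖ`. [cite: Jozsa2003, §9 Thm. 5] -/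
def toWalkData : WalkData ι where
  unit := O.unit d
  rho := O.rho d
  star := O.star d
  ghat := fun a => (O.gInt d a : ℚ) / 2 ^ O.prec d
  khat := fun a b => (O.kInt d a b : ℚ) / 2 ^ O.prec d
  K := (O.KInt d : ℚ) / 2 ^ O.prec d

/-- Integer states `(a, D̂)`, meaning `(a, D̂/2ᵖ)`. [folklore] -/
abbrev StI (ι : Type) := ι × ℤ

/-- Reading an integer state as a rational state. [folklore] -/
def cast (s : StI ι) : St ι := (s.1, (s.2 : ℚ) / 2 ^ O.prec d)

/-- The scale `2ᵖ` is positive. [folklore] -/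
theorem two_pow_pos : (0 : ℚ) < 2 ^ O.prec d := by positivity

/-! ### The integer programs -/

/-- Integer baby step. [cite: Jozsa2003, §9 Thm. 5] -/
def babyI (s : StI ι) : StI ι := (O.rho d s.1, s.2 + O.gInt d s.1)

/-- Integer giant step. [cite: Jozsa2003, §9 Thm. 5] -/
def giantI (s t : StI ι) : StI ι := (O.star d s.1 t.1, s.2 + t.2 + O.kInt d s.1 t.1)

/-- Integer start-up round: advance while `D̂ < 2 KInt + 2ᵖ` (i.e. `d̂ < 2K + 1`). [cite: Jozsa2003, §9 Thm. 5] -/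
def startStepI (s : StI ι) : StI ι :=
  if s.2 < 2 * (O.KInt d : ℤ) + 2 ^ O.prec d then O.babyI d s else s

/-- Integer start-up state. [cite: Jozsa2003, §9 Thm. 5] -/
def startI (s₀ : ℕ) : StI ι := (O.startStepI d)^[s₀] (O.unit d, 0)

/-- Integer doubling sequence. [cite: Jozsa2003, §7.1 Prop. 35] -/
def dblI (s₀ : ℕ) : ℕ → StI ι
  | 0 => O.startI d s₀
  | k + 1 => O.giantI d (dblI s₀ k) (dblI s₀ k)

/-- The comparison `d̂ ≤ v/N` on integers: `D̂ · N ≤ v · 2ᵖ`. [folklore] -/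
def leTarget (v : ℤ) (N : ℕ) (D : ℤ) : Prop := D * N ≤ v * 2 ^ O.prec d

/-- The target comparison is decidable (an integer inequality). [folklore] -/
instance (v : ℤ) (N : ℕ) (D : ℤ) : Decidable (O.leTarget d v N D) := inferInstanceAs (Decidable (_ ≤ _))

/-- Integer descent round towards `x = v/N`. [cite: Jozsa2003, §9 Thm. 5] -/
def descStepI (v : ℤ) (N s₀ : ℕ) (J : StI ι) (k : ℕ) : StI ι :=
  if O.leTarget d v N (O.giantI d J (O.dblI d s₀ k)).2 then O.giantI d J (O.dblI d s₀ k) else J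

/-- Integer descent through the levels `≥ k`. [cite: Jozsa2003, §9 Thm. 5] -/
def descentFromI (v : ℤ) (N s₀ T : ℕ) (k : ℕ) : StI ι :=
  ((List.range' k (T - k)).reverse).foldl (O.descStepI d v N s₀) (O.unit d, 0)

/-- Integer final round. [cite: Jozsa2003, §9 Thm. 5] -/
def finStepI (v : ℤ) (N : ℕ) (J : StI ι) : StI ι :=
  if O.leTarget d v N (O.babyI d J).2 then O.babyI d J else J

/-- **The integer walk** to `x = v/N`. [cite: Jozsa2003, §9 Thm. 5] -/
def finalI (v : ℤ) (N s₀ T B : ℕ) : StI ι := (O.finStepI d v N)^[B] (O.descentFromI d v N s₀ T 0)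

/-- The integer ceiling `⌈N D̂ / 2ᵖ⌉` by floor division: `−((−N D̂) / 2ᵖ)`. [folklore] -/
def ceilScaled (N : ℕ) (D : ℤ) : ℤ := -((-(N * D)) / (2 ^ O.prec d : ℤ))

/-- **The integer table**: label and offset `v − ⌈N d̂⌉` of the walk to `v/N`. [cite: Jozsa2003, §10 (h̃_N)] -/
def tableI (N s₀ T B : ℕ) (v : ℤ) : ι × ℤ :=
  ((O.finalI d v N s₀ T B).1, v - O.ceilScaled d N (O.finalI d v N s₀ T B).2)

/-! ### Correspondence with the rational walk -/

/-- Baby steps correspond. [folklore] -/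
theorem cast_babyI (s : StI ι) : O.cast d (O.babyI d s) = (O.toWalkData d).babyStep (O.cast d s) := by
  simp only [cast, babyI, WalkData.babyStep, toWalkData]
  push_cast
  rw [add_div]

/-- Giant steps correspond. [folklore] -/
theorem cast_giantI (s t : StI ι) :
    O.cast d (O.giantI d s t) = (O.toWalkData d).giantStep (O.cast d s) (O.cast d t) := by
  simp only [cast, giantI, WalkData.giantStep, toWalkData]
  push_cast
  rw [add_div, add_div]

/-- The start-up threshold corresponds: `D̂ < 2 KInt + 2ᵖ ↔ D̂/2ᵖ < 2K + 1`. [folklore] -/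
theorem startThreshold_iff (D : ℤ) :
    D < 2 * (O.KInt d : ℤ) + 2 ^ O.prec d ↔ (D : ℚ) / 2 ^ O.prec d < 2 * (O.toWalkData d).K + 1 := by
  have h2 := O.two_pow_pos d
  simp only [toWalkData]
  rw [div_lt_iff₀ h2, show (2 * ((O.KInt d : ℚ) / 2 ^ O.prec d) + 1) * 2 ^ O.prec d =
    ((2 * (O.KInt d : ℤ) + 2 ^ O.prec d : ℤ) : ℚ) by push_cast; field_simp]
  exact_mod_cast Iff.rfl

/-- Start-up rounds correspond. [folklore] -/
theorem cast_startStepI (s : StI ι) :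
    O.cast d (O.startStepI d s) = (O.toWalkData d).startStep (O.cast d s) := by
  unfold startStepI WalkData.startStep
  have hiff := O.startThreshold_iff d s.2
  have hc : (O.cast d s).2 = (s.2 : ℚ) / 2 ^ O.prec d := rfl
  rw [hc]
  by_cases h : s.2 < 2 * (O.KInt d : ℤ) + 2 ^ O.prec d
  · rw [if_pos h, if_pos (hiff.mp h), cast_babyI]
  · rw [if_neg h, if_neg (fun h' => h (hiff.mpr h'))]

/-- **Start-up states correspond.** [folklore] -/
theorem cast_startI (s₀ : ℕ) : O.cast d (O.startI d s₀) = (O.toWalkData d).start s₀ := by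
  induction s₀ with
  | zero => simp [startI, WalkData.start, cast, toWalkData]
  | succ j ih =>
    rw [startI, Function.iterate_succ_apply', ← startI, cast_startStepI, ih, WalkData.start,
      WalkData.start, Function.iterate_succ_apply']

/-- **Doubling sequences correspond.** [folklore] -/
theorem cast_dblI (s₀ k : ℕ) : O.cast d (O.dblI d s₀ k) = (O.toWalkData d).dbl s₀ k := by
  induction k with
  | zero => exact O.cast_startI d s₀
  | succ k ih => rw [dblI, cast_giantI, ih]; rfl

/-- The target comparison corresponds: `D̂ N ≤ v 2ᵖ ↔ D̂/2ᵖ ≤ v/N` (`N > 0`). [folklore] -/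
theorem leTarget_iff {N : ℕ} (hN : 0 < N) (v D : ℤ) :
    O.leTarget d v N D ↔ (D : ℚ) / 2 ^ O.prec d ≤ (v : ℚ) / N := by
  have h2 := O.two_pow_pos d
  have hNq : (0 : ℚ) < N := by exact_mod_cast hN
  unfold leTarget
  rw [div_le_div_iff₀ h2 hNq]
  constructor
  · intro h; exact_mod_cast h
  · intro h; exact_mod_cast h

/-- Descent rounds correspond. [folklore] -/
theorem cast_descStepI {N : ℕ} (hN : 0 < N) (v : ℤ) (s₀ : ℕ) (J : StI ι) (k : ℕ) :
    O.cast d (O.descStepI d v N s₀ J k) = (O.toWalkData d).descStep ((v : ℚ) / N) s₀ (O.cast d J) k := by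
  unfold descStepI WalkData.descStep
  have hg : (O.toWalkData d).giantStep (O.cast d J) ((O.toWalkData d).dbl s₀ k) =
      O.cast d (O.giantI d J (O.dblI d s₀ k)) := by rw [cast_giantI, cast_dblI]
  rw [hg]
  have hiff := O.leTarget_iff d hN v (O.giantI d J (O.dblI d s₀ k)).2
  have hc : (O.cast d (O.giantI d J (O.dblI d s₀ k))).2 = ((O.giantI d J (O.dblI d s₀ k)).2 : ℚ) / 2 ^ O.prec d := rfl
  rw [hc]
  by_cases h : O.leTarget d v N (O.giantI d J (O.dblI d s₀ k)).2
  · rw [if_pos h, if_pos (hiff.mp h)]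
  · rw [if_neg h, if_neg (fun h' => h (hiff.mpr h'))]

/-- **Descents correspond.** [folklore] -/
theorem cast_descentFromI {N : ℕ} (hN : 0 < N) (v : ℤ) (s₀ T k : ℕ) :
    O.cast d (O.descentFromI d v N s₀ T k) = (O.toWalkData d).descentFrom ((v : ℚ) / N) s₀ T k := by
  unfold descentFromI WalkData.descentFrom
  -- fold correspondence along any list of levels
  suffices H : ∀ (l : List ℕ) (J : StI ι),
      O.cast d (l.foldl (O.descStepI d v N s₀) J) =
        l.foldl ((O.toWalkData d).descStep ((v : ℚ) / N) s₀) (O.cast d J) by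
    have h0 : O.cast d (O.unit d, 0) = ((O.toWalkData d).unit, 0) := by simp [cast, toWalkData]
    rw [H, h0]
  intro l
  induction l with
  | nil => intro J; rfl
  | cons a l ih => intro J; rw [List.foldl_cons, List.foldl_cons, ih, cast_descStepI _ _ hN]

/-- Final rounds correspond. [folklore] -/
theorem cast_finStepI {N : ℕ} (hN : 0 < N) (v : ℤ) (J : StI ι) :
    O.cast d (O.finStepI d v N J) = (O.toWalkData d).finStep ((v : ℚ) / N) (O.cast d J) := by
  unfold finStepI WalkData.finStep
  rw [← cast_babyI]
  have hiff := O.leTarget_iff d hN v (O.babyI d J).2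
  have hc : (O.cast d (O.babyI d J)).2 = ((O.babyI d J).2 : ℚ) / 2 ^ O.prec d := rfl
  rw [hc]
  by_cases h : O.leTarget d v N (O.babyI d J).2
  · rw [if_pos h, if_pos (hiff.mp h)]
  · rw [if_neg h, if_neg (fun h' => h (hiff.mpr h'))]

/-- **The integer walk is the rational walk.** [cite: Jozsa2003, §9 Thm. 5] -/
theorem cast_finalI {N : ℕ} (hN : 0 < N) (v : ℤ) (s₀ T B : ℕ) :
    O.cast d (O.finalI d v N s₀ T B) = (O.toWalkData d).final ((v : ℚ) / N) s₀ T B := by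
  unfold finalI WalkData.final WalkData.descent
  induction B with
  | zero => simpa using O.cast_descentFromI d hN v s₀ T 0
  | succ B ih => rw [Function.iterate_succ_apply', Function.iterate_succ_apply', cast_finStepI _ _ hN, ih]

/-- The scaled ceiling is the ceiling. [folklore] -/
theorem ceilScaled_eq (N : ℕ) (D : ℤ) : O.ceilScaled d N D = ⌈(N : ℚ) * ((D : ℚ) / 2 ^ O.prec d)⌉ := by
  unfold ceilScaled
  have h2 : (0 : ℤ) < 2 ^ O.prec d := by positivity
  rw [show (N : ℚ) * ((D : ℚ) / 2 ^ O.prec d) = ((N * D : ℤ) : ℚ) / ((2 ^ O.prec d : ℤ) : ℚ) by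
    push_cast; ring]
  rw [eq_comm, Int.ceil_eq_iff]
  have hfl := Int.ediv_mul_le (-(N * D)) h2.ne'
  have hlt := Int.lt_ediv_add_one_mul_self (-(N * D)) h2
  set qz := -(N * D) / 2 ^ O.prec d with hqz
  have h2q : (0 : ℚ) < ((2 ^ O.prec d : ℤ) : ℚ) := by exact_mod_cast h2
  have hlt' : (((-(N * D) : ℤ)) : ℚ) < ((qz + 1 : ℤ) : ℚ) * ((2 ^ O.prec d : ℤ) : ℚ) := by exact_mod_cast hlt
  have hfl' : ((qz * 2 ^ O.prec d : ℤ) : ℚ) ≤ (((-(N * D) : ℤ)) : ℚ) := by exact_mod_cast hfl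
  have e : (((N * D : ℤ)) : ℚ) / ((2 ^ O.prec d : ℤ) : ℚ) =
      -((((-(N * D) : ℤ)) : ℚ) / ((2 ^ O.prec d : ℤ) : ℚ)) := by push_cast; ring
  have hq1 : (((-(N * D) : ℤ)) : ℚ) / ((2 ^ O.prec d : ℤ) : ℚ) < qz + 1 := by
    rw [div_lt_iff₀ h2q]; push_cast at hlt' ⊢; linarith
  have hq2 : (qz : ℚ) ≤ (((-(N * D) : ℤ)) : ℚ) / ((2 ^ O.prec d : ℤ) : ℚ) := by
    rw [le_div_iff₀ h2q]; push_cast at hfl' ⊢; linarith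
  rw [e, Int.cast_neg]
  constructor <;> linarith

/-- **The integer table is the table** of the rational walk. [cite: Jozsa2003, §10 (h̃_N)] -/
theorem tableI_eq_table {N : ℕ} (hN : 0 < N) (s₀ T B : ℕ) (v : ℤ) :
    O.tableI d N s₀ T B v = (O.toWalkData d).table N s₀ T B v := by
  unfold tableI WalkData.table
  have h := O.cast_finalI d hN v s₀ T B
  have h1 : (O.finalI d v N s₀ T B).1 = ((O.toWalkData d).final ((v : ℚ) / N) s₀ T B).1 := by
    rw [← h]; rfl
  have h2 : ((O.finalI d v N s₀ T B).2 : ℚ) / 2 ^ O.prec d = ((O.toWalkData d).final ((v : ℚ) / N) s₀ T B).2 := by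
    rw [← h]; rfl
  rw [h1, ceilScaled_eq, h2]

/-! ### The descent by rounds that recompute their level -/

/-- Before any level is processed the integer descent is at the unit ideal. [folklore] -/
theorem descentFromI_top (v : ℤ) (N s₀ T : ℕ) : O.descentFromI d v N s₀ T T = (O.unit d, 0) := by
  simp [descentFromI]

/-- Peeling the lowest processed level of the integer descent. [folklore] -/
theorem descentFromI_pred (v : ℤ) (N s₀ : ℕ) {T k : ℕ} (hk : k < T) :
    O.descentFromI d v N s₀ T k = O.descStepI d v N s₀ (O.descentFromI d v N s₀ T (k + 1)) k := by
  unfold descentFromI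
  have : List.range' k (T - k) = k :: List.range' (k + 1) (T - (k + 1)) := by
    rw [show T - k = (T - (k + 1)) + 1 by omega, List.range'_succ]
  rw [this, List.reverse_cons, List.foldl_append, List.foldl_cons, List.foldl_nil]

/-- **One descent round with a level counter**: at counter `k ≥ 1`, process level `k − 1` —
recomputing `I_{min(k−1, T)}` from scratch (the cap `T` is inactive on a genuine run, `k ≤ T`) — and
decrement; at `0`, stay. [cite: Jozsa2003, §9 Thm. 5] -/
def descRound (v : ℤ) (N s₀ T : ℕ) (Jk : StI ι × ℕ) : StI ι × ℕ :=
  if Jk.2 = 0 then Jk else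
    ((if O.leTarget d v N (O.giantI d Jk.1 (O.dblI d s₀ (min (Jk.2 - 1) T))).2 then
        O.giantI d Jk.1 (O.dblI d s₀ (min (Jk.2 - 1) T)) else Jk.1), Jk.2 - 1)

/-- `j ≤ T` rounds from `((unit, 0), T)` reach the descent with the levels `≥ T − j` processed.
[folklore] -/
theorem descRound_iterate (v : ℤ) (N s₀ T : ℕ) {j : ℕ} (hj : j ≤ T) :
    (O.descRound d v N s₀ T)^[j] ((O.unit d, 0), T) = (O.descentFromI d v N s₀ T (T - j), T - j) := by
  induction j with
  | zero => simp [descentFromI_top]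
  | succ j ih =>
    rw [Function.iterate_succ_apply', ih (by omega), descRound, if_neg (by simp; omega)]
    have hk : T - (j + 1) < T := by omega
    simp only
    rw [show T - j - 1 = T - (j + 1) by omega, min_eq_left hk.le, O.descentFromI_pred d v N s₀ hk,
      show T - (j + 1) + 1 = T - j by omega]
    rfl

/-- **`T` rounds give the full integer descent.** [folklore] -/
theorem descRound_iterate_self (v : ℤ) (N s₀ T : ℕ) :
    ((O.descRound d v N s₀ T)^[T] ((O.unit d, 0), T)).1 = O.descentFromI d v N s₀ T 0 := by
  rw [O.descRound_iterate d v N s₀ T le_rfl, Nat.sub_self]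

/-! ### Polynomial time: the specification of a computable family -/

section FP

open Literature.Computability.Complexity Literature.Computability.Complexity.CodeFP Polynomial

variable {eδ : δ → List Bool} {eι : ι → List Bool}

/-- **A family of integer walk operations computed on codes**, with a validity predicate closed
under the steps (the reduced ideals of the instance) on which labels and evaluator values have
codes polynomially bounded in the instance code. [cite: Jozsa2003, §9 Thm. 5 ("each reduced ideal will have a poly log d sized description")] -/
structure FPSpec (O : IntWalkOps δ ι) (eδ : δ → List Bool) (eι : ι → List Bool) where
  /-- the valid labels of instance `d` -/
  Valid : δ → ι → Prop
  /-- the unit ideal is valid -/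
  valid_unit : ∀ d, Valid d (O.unit d)
  /-- baby steps preserve validity -/
  valid_rho : ∀ d a, Valid d a → Valid d (O.rho d a)
  /-- giant steps preserve validity -/
  valid_star : ∀ d a b, Valid d a → Valid d b → Valid d (O.star d a b)
  /-- one polynomial bounding everything in the instance code length -/
  bound : Polynomial ℕ
  /-- valid labels are short -/
  len_lab : ∀ d a, Valid d a → (eι a).length ≤ bound.eval (eδ d).length
  /-- gap values are short -/
  len_g : ∀ d a, Valid d a → (intE (O.gInt d a)).length ≤ bound.eval (eδ d).length
  /-- defect values are short -/
  len_k : ∀ d a b, Valid d a → Valid d b → (intE (O.kInt d a b)).length ≤ bound.eval (eδ d).length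
  /-- the unit ideal is computable -/
  h_unit : CodeFP eδ eι (fun d => O.unit d)
  /-- the baby step is computable -/
  h_rho : CodeFP (pairE eδ eι) eι (fun p => O.rho p.1 p.2)
  /-- the giant step is computable -/
  h_star : CodeFP (pairE eδ (pairE eι eι)) eι (fun p => O.star p.1 p.2.1 p.2.2)
  /-- the gap evaluator is computable -/
  h_g : CodeFP (pairE eδ eι) intE (fun p => O.gInt p.1 p.2)
  /-- the defect evaluator is computable -/
  h_k : CodeFP (pairE eδ (pairE eι eι)) intE (fun p => O.kInt p.1 p.2.1 p.2.2)
  /-- the defect bound is computable -/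
  h_K : CodeFP eδ natE (fun d => O.KInt d)
  /-- the precision is computable, in unary -/
  h_prec : CodeFP eδ unE (fun d => O.prec d)

/-- The state code. [folklore] -/
abbrev stE (eι : ι → List Bool) : StI ι → List Bool := pairE eι intE

/-! #### Size lemmas -/

/-- `|z| < 2^{|intE z|}` (a two-line restatement of `QuantumComplexity.natAbs_lt_two_pow_length_intE`
from `GramSchmidtTableMachine.lean`, whose Euclidean-lattice imports are foreign to this file). [folklore] -/
theorem natAbs_lt_two_pow_length (z : ℤ) : z.natAbs < 2 ^ (intE z).length :=
  lt_of_lt_of_le (Nat.lt_size_self _) (Nat.pow_le_pow_right (by norm_num) (size_natAbs_le_length_intE z))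

/-- `|intE z| ≤ 3 size|z| + 2`. [folklore] -/
theorem length_intE_le (z : ℤ) : (intE z).length ≤ 3 * z.natAbs.size + 2 := Brick.length_dpEnc_le z

/-- `size (m · 2^e) ≤ size m + e`. [folklore] -/
theorem size_mul_two_pow_le (m e : ℕ) : (m * 2 ^ e).size ≤ m.size + e := by
  rcases Nat.eq_zero_or_pos m with rfl | hm
  · simp
  · rw [← Nat.shiftLeft_eq, Nat.size_shiftLeft (by omega)]

/-- Folding a constant step over units is iteration. [folklore] -/
theorem foldl_units_eq_iterate {β : Type} (f : β → β) (b : β) (l : List Unit) :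
    l.foldl (fun acc _ => f acc) b = f^[l.length] b := by
  induction l generalizing b with
  | nil => rfl
  | cons u l ih => rw [List.foldl_cons, ih, List.length_cons, Function.iterate_succ_apply]

namespace FPSpec

variable {O}
variable (S : O.FPSpec eδ eι)

/-- A state with a valid label and `|D̂| ≤ m 2^{B(d)}` has a short code:
`≤ 5B + 3 size m + 9`. [folklore] -/
theorem length_stE_le {d : δ} {s : StI ι} (hv : S.Valid d s.1) {m : ℕ}
    (hD : s.2.natAbs ≤ m * 2 ^ S.bound.eval (eδ d).length) :
    (stE eι s).length ≤ 5 * S.bound.eval (eδ d).length + 3 * m.size + 9 := by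
  have h1 := S.len_lab d s.1 hv
  have h2 := length_intE_le s.2
  have h3 : s.2.natAbs.size ≤ m.size + S.bound.eval (eδ d).length :=
    (Nat.size_le_size hD).trans (size_mul_two_pow_le m _)
  simp only [pairE_apply, length_boolPair]
  omega

/-- Evaluator values are `< 2^{B(d)}` in absolute value. [folklore] -/
theorem natAbs_gInt_lt {d : δ} {a : ι} (hv : S.Valid d a) : (O.gInt d a).natAbs < 2 ^ S.bound.eval (eδ d).length :=
  lt_of_lt_of_le (natAbs_lt_two_pow_length _) (Nat.pow_le_pow_right (by norm_num) (S.len_g d a hv))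

/-- Defect values are `< 2^{B(d)}` in absolute value. [folklore] -/
theorem natAbs_kInt_lt {d : δ} {a b : ι} (ha : S.Valid d a) (hb : S.Valid d b) :
    (O.kInt d a b).natAbs < 2 ^ S.bound.eval (eδ d).length :=
  lt_of_lt_of_le (natAbs_lt_two_pow_length _) (Nat.pow_le_pow_right (by norm_num) (S.len_k d a b ha hb))

include S

/-! #### The steps on codes -/

/-- **The integer baby step is computable**: `(d, (a, D̂)) ↦ (ρ a, D̂ + gInt a)`. [cite: Jozsa2003, §9 Thm. 5] -/
theorem codeFP_babyI : CodeFP (pairE eδ (stE eι)) (stE eι) (fun p => O.babyI p.1 p.2) := by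
  have hd : CodeFP (pairE eδ (stE eι)) eδ (fun p => p.1) := fst _ _
  have ha : CodeFP (pairE eδ (stE eι)) eι (fun p => p.2.1) := (snd _ _).fst'
  have hD : CodeFP (pairE eδ (stE eι)) intE (fun p => p.2.2) := (snd _ _).snd'
  have h1 : CodeFP (pairE eδ (stE eι)) eι (fun p => O.rho p.1 p.2.1) := (S.h_rho.comp (hd.pair ha) :)
  have h2 : CodeFP (pairE eδ (stE eι)) intE (fun p => p.2.2 + O.gInt p.1 p.2.1) :=
    (intAdd.comp (hD.pair (S.h_g.comp (hd.pair ha))) :)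
  exact (h1.pair h2).congr fun _ => rfl

/-- **The integer giant step is computable.** [cite: Jozsa2003, §7.1, §9 Thm. 5] -/
theorem codeFP_giantI : CodeFP (pairE eδ (pairE (stE eι) (stE eι))) (stE eι) (fun p => O.giantI p.1 p.2.1 p.2.2) := by
  have hd : CodeFP (pairE eδ (pairE (stE eι) (stE eι))) eδ (fun p => p.1) := fst _ _
  have ha : CodeFP (pairE eδ (pairE (stE eι) (stE eι))) eι (fun p => p.2.1.1) := (snd _ _).fst'.fst'
  have hDa : CodeFP (pairE eδ (pairE (stE eι) (stE eι))) intE (fun p => p.2.1.2) := (snd _ _).fst'.snd'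
  have hb : CodeFP (pairE eδ (pairE (stE eι) (stE eι))) eι (fun p => p.2.2.1) := (snd _ _).snd'.fst'
  have hDb : CodeFP (pairE eδ (pairE (stE eι) (stE eι))) intE (fun p => p.2.2.2) := (snd _ _).snd'.snd'
  have h1 : CodeFP (pairE eδ (pairE (stE eι) (stE eι))) eι (fun p => O.star p.1 p.2.1.1 p.2.2.1) :=
    (S.h_star.comp (hd.pair (ha.pair hb)) :)
  have h2 : CodeFP (pairE eδ (pairE (stE eι) (stE eι))) intE
      (fun p => p.2.1.2 + p.2.2.2 + O.kInt p.1 p.2.1.1 p.2.2.1) :=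
    (intAdd.comp ((intAdd.comp (hDa.pair hDb)).pair (S.h_k.comp (hd.pair (ha.pair hb)))) :)
  exact (h1.pair h2).congr fun _ => rfl

/-- The scale `2ᵖ` as an integer code, from the instance. [folklore] -/
theorem codeFP_twoPowPrec : CodeFP eδ intE (fun d => ((2 : ℤ) ^ O.prec d)) :=
  (intPow.comp ((const _ (2 : ℤ)).pair S.h_prec) :)

/-- **The start-up round is computable.** [cite: Jozsa2003, §9 Thm. 5] -/
theorem codeFP_startStepI : CodeFP (pairE eδ (stE eι)) (stE eι) (fun p => O.startStepI p.1 p.2) := by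
  have hd : CodeFP (pairE eδ (stE eι)) eδ (fun p => p.1) := fst _ _
  have hD : CodeFP (pairE eδ (stE eι)) intE (fun p => p.2.2) := (snd _ _).snd'
  have hthr : CodeFP (pairE eδ (stE eι)) intE (fun p => 2 * (O.KInt p.1 : ℤ) + 2 ^ O.prec p.1) :=
    (intAdd.comp ((intMul.comp ((const _ (2 : ℤ)).pair (intOfNat.comp (S.h_K.comp hd)))).pair
      (S.codeFP_twoPowPrec.comp hd)) :)
  have hc : CodeFP (pairE eδ (stE eι)) bitE (fun p => decide (p.2.2 < 2 * (O.KInt p.1 : ℤ) + 2 ^ O.prec p.1)) :=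
    (intLt.comp (hD.pair hthr) :)
  refine ((hc.ite S.codeFP_babyI (snd _ _)).congr fun p => ?_)
  unfold startStepI
  by_cases h : p.2.2 < 2 * (O.KInt p.1 : ℤ) + 2 ^ O.prec p.1 <;> simp [h]

/-! #### The start-up fold -/

/-- Validity and size along the start-up: after `j` rounds the label is valid and
`|D̂| ≤ j · 2^{B(d)}`. [cite: Jozsa2003, §9 Thm. 5] -/
theorem valid_startI (d : δ) (j : ℕ) :
    S.Valid d (O.startI d j).1 ∧ (O.startI d j).2.natAbs ≤ j * 2 ^ S.bound.eval (eδ d).length := by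
  induction j with
  | zero => exact ⟨by simpa [startI] using S.valid_unit d, by simp [startI]⟩
  | succ j ih =>
    obtain ⟨hv, hD⟩ := ih
    rw [startI, Function.iterate_succ_apply', ← startI]
    unfold startStepI
    split_ifs
    · refine ⟨S.valid_rho d _ hv, ?_⟩
      simp only [babyI]
      have hg := S.natAbs_gInt_lt hv (a := (O.startI d j).1)
      calc ((O.startI d j).2 + O.gInt d (O.startI d j).1).natAbs
          ≤ (O.startI d j).2.natAbs + (O.gInt d (O.startI d j).1).natAbs := Int.natAbs_add_le _ _
        _ ≤ j * 2 ^ S.bound.eval (eδ d).length + 2 ^ S.bound.eval (eδ d).length := by omega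
        _ = (j + 1) * 2 ^ S.bound.eval (eδ d).length := by ring
    · exact ⟨hv, hD.trans (Nat.mul_le_mul_right _ (Nat.le_succ j))⟩

/-- **The integer start-up is computable**: `(d, 1^{s₀}) ↦ startI d s₀`. [cite: Jozsa2003, §9 Thm. 5] -/
theorem codeFP_startI : CodeFP (pairE eδ unE) (stE eι) (fun p => O.startI p.1 p.2) := by
  have hstep : CodeFP (pairE eδ (pairE unitE (stE eι))) (stE eι) (fun t => O.startStepI t.1 t.2.2) :=
    (S.codeFP_startStepI.comp ((fst _ _).pair (snd _ _).snd') :)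
  have hinit : CodeFP eδ (stE eι) (fun d => (O.unit d, (0 : ℤ))) := S.h_unit.pair (const _ (0 : ℤ))
  have h := foldl (σ := δ) (α := Unit) (β := StI ι) (eσ := eδ) (eα := unitE) (eβ := stE eι)
    (step := fun d _ b => O.startStepI d b) (init := fun d => (O.unit d, 0)) hstep hinit
    (5 * S.bound + 3 * X + 9)
    (fun d l₁ l₂ => by
      rw [foldl_units_eq_iterate, ← startI]
      obtain ⟨hv, hD⟩ := S.valid_startI d l₁.length
      refine (S.length_stE_le hv hD).trans ?_
      simp only [eval_add, eval_mul, eval_ofNat, eval_X]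
      have hL : (eδ d).length ≤ (pairE eδ (rawE unitE) (d, l₁ ++ l₂)).length := by
        simp only [pairE_apply, length_boolPair]; omega
      have h1 := TM2Iter.eval_mono S.bound hL
      have h2 : l₁.length.size ≤ (pairE eδ (rawE unitE) (d, l₁ ++ l₂)).length := by
        refine (Nat.size_le.2 (Nat.lt_two_pow_self)).trans ?_
        simp only [pairE_apply, length_boolPair]
        have := length_le_length_rawE unitE (l₁ ++ l₂)
        simp only [List.length_append] at this
        omega
      omega)
  refine ((h.comp ((fst eδ unE).pair (replicateUnit.comp (snd eδ unE)))).congr fun p => ?_)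
  simp only [foldl_units_eq_iterate, List.length_replicate]
  rfl

/-! #### Validity and size invariants -/

/-- Levels are valid with `|D̂(I_k)| ≤ 2^{k+1}(s₀+1) 2^{B(d)}`. [cite: Jozsa2003, §7.1 Prop. 35] -/
theorem valid_dblI (d : δ) (s₀ k : ℕ) :
    S.Valid d (O.dblI d s₀ k).1 ∧
      (O.dblI d s₀ k).2.natAbs ≤ (2 ^ (k + 1) * (s₀ + 1)) * 2 ^ S.bound.eval (eδ d).length := by
  have hval : ∀ k, S.Valid d (O.dblI d s₀ k).1 := by
    intro k
    induction k with
    | zero => exact (S.valid_startI d s₀).1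
    | succ k ih => exact S.valid_star d _ _ ih ih
  refine ⟨hval k, ?_⟩
  set Λ := 2 ^ S.bound.eval (eδ d).length with hΛ
  have key : ∀ k, (O.dblI d s₀ k).2.natAbs + (s₀ + 1) * Λ ≤ 2 ^ (k + 1) * ((s₀ + 1) * Λ) := by
    intro k
    induction k with
    | zero =>
      have := (S.valid_startI d s₀).2
      simp only [dblI, zero_add, pow_one]
      rw [← hΛ] at this
      nlinarith
    | succ k ih =>
      simp only [dblI, giantI]
      have h1 := (S.natAbs_kInt_lt (hval k) (hval k)).le
      rw [← hΛ] at h1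
      have h2 : ((O.dblI d s₀ k).2 + (O.dblI d s₀ k).2 + O.kInt d (O.dblI d s₀ k).1 (O.dblI d s₀ k).1).natAbs ≤
          (O.dblI d s₀ k).2.natAbs + (O.dblI d s₀ k).2.natAbs + (O.kInt d (O.dblI d s₀ k).1 (O.dblI d s₀ k).1).natAbs :=
        (Int.natAbs_add_le _ _).trans (Nat.add_le_add_right (Int.natAbs_add_le _ _) _)
      have hΛ' : Λ ≤ (s₀ + 1) * Λ := Nat.le_mul_of_pos_left Λ (Nat.succ_pos s₀)
      rw [pow_succ]
      nlinarith
  have := key k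
  nlinarith [Nat.zero_le ((s₀ + 1) * Λ)]

/-- **The descent keeps valid, bounded states**: after the levels `≥ k`, the label is valid and
`|D̂| ≤ (T − k)(2^T(s₀+1) + 1) 2^{B(d)}`. [cite: Jozsa2003, §9 Thm. 5] -/
theorem valid_descentFromI (d : δ) (v : ℤ) (N s₀ T : ℕ) :
    ∀ k, k ≤ T → S.Valid d (O.descentFromI d v N s₀ T k).1 ∧
      (O.descentFromI d v N s₀ T k).2.natAbs ≤ ((T - k) * (2 ^ T * (s₀ + 1) + 1)) * 2 ^ S.bound.eval (eδ d).length := by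
  intro k hk
  induction' hT : T - k with j ih generalizing k
  · have : k = T := by omega
    subst this
    rw [descentFromI_top]
    exact ⟨S.valid_unit d, by simp⟩
  · have hkT : k < T := by omega
    obtain ⟨hv, hD⟩ := ih (k + 1) (by omega) (by omega)
    rw [O.descentFromI_pred d v N s₀ hkT]
    obtain ⟨hvl, hDl⟩ := S.valid_dblI d s₀ k
    have hlev : (O.dblI d s₀ k).2.natAbs ≤ (2 ^ T * (s₀ + 1)) * 2 ^ S.bound.eval (eδ d).length :=
      hDl.trans (Nat.mul_le_mul_right _ (Nat.mul_le_mul_right _ (Nat.pow_le_pow_right (by norm_num) hkT)))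
    unfold descStepI
    split_ifs
    · refine ⟨S.valid_star d _ _ hv hvl, ?_⟩
      simp only [giantI]
      have hkk := (S.natAbs_kInt_lt hv hvl).le
      calc ((O.descentFromI d v N s₀ T (k + 1)).2 + (O.dblI d s₀ k).2 +
            O.kInt d (O.descentFromI d v N s₀ T (k + 1)).1 (O.dblI d s₀ k).1).natAbs
          ≤ (O.descentFromI d v N s₀ T (k + 1)).2.natAbs + (O.dblI d s₀ k).2.natAbs +
              (O.kInt d (O.descentFromI d v N s₀ T (k + 1)).1 (O.dblI d s₀ k).1).natAbs :=
            (Int.natAbs_add_le _ _).trans (Nat.add_le_add_right (Int.natAbs_add_le _ _) _)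
        _ ≤ (j * (2 ^ T * (s₀ + 1) + 1)) * 2 ^ S.bound.eval (eδ d).length +
              (2 ^ T * (s₀ + 1)) * 2 ^ S.bound.eval (eδ d).length + 2 ^ S.bound.eval (eδ d).length := by
            omega
        _ = ((j + 1) * (2 ^ T * (s₀ + 1) + 1)) * 2 ^ S.bound.eval (eδ d).length := by ring
    · refine ⟨hv, hD.trans (Nat.mul_le_mul_right _ (Nat.mul_le_mul_right _ (by omega)))⟩

/-- The final fold keeps valid, bounded states. [cite: Jozsa2003, §9 Thm. 5] -/
theorem valid_iterate_finStepI (d : δ) (v : ℤ) (N : ℕ) (J : StI ι) (hJ : S.Valid d J.1) (m : ℕ)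
    (hJD : J.2.natAbs ≤ m * 2 ^ S.bound.eval (eδ d).length) (j : ℕ) :
    S.Valid d ((O.finStepI d v N)^[j] J).1 ∧
      ((O.finStepI d v N)^[j] J).2.natAbs ≤ (m + j) * 2 ^ S.bound.eval (eδ d).length := by
  induction j with
  | zero => simpa using And.intro hJ hJD
  | succ j ih =>
    obtain ⟨hv, hD⟩ := ih
    rw [Function.iterate_succ_apply']
    unfold finStepI
    split_ifs
    · refine ⟨S.valid_rho d _ hv, ?_⟩
      simp only [babyI]
      have hg := (S.natAbs_gInt_lt hv (a := ((O.finStepI d v N)^[j] J).1)).le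
      calc (((O.finStepI d v N)^[j] J).2 + O.gInt d ((O.finStepI d v N)^[j] J).1).natAbs
          ≤ ((O.finStepI d v N)^[j] J).2.natAbs + (O.gInt d ((O.finStepI d v N)^[j] J).1).natAbs :=
            Int.natAbs_add_le _ _
        _ ≤ (m + j) * 2 ^ S.bound.eval (eδ d).length + 2 ^ S.bound.eval (eδ d).length := by omega
        _ = (m + (j + 1)) * 2 ^ S.bound.eval (eδ d).length := by ring
    · exact ⟨hv, hD.trans (Nat.mul_le_mul_right _ (by omega))⟩

/-! #### The doubling on codes -/

/-- **The doubling level is computable**: `(d, 1^{s₀}, 1^k) ↦ dblI d s₀ k` (a fold of the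
self-giant-step over `k` units). [cite: Jozsa2003, §7.1 Prop. 35, §9 Thm. 5] -/
theorem codeFP_dblI : CodeFP (pairE eδ (pairE unE unE)) (stE eι) (fun p => O.dblI p.1 p.2.1 p.2.2) := by
  have hstep : CodeFP (pairE (pairE eδ unE) (pairE unitE (stE eι))) (stE eι) (fun t => O.giantI t.1.1 t.2.2 t.2.2) :=
    (S.codeFP_giantI.comp ((fst _ _).fst'.pair ((snd _ _).snd'.pair (snd _ _).snd')) :)
  have hinit : CodeFP (pairE eδ unE) (stE eι) (fun c => O.startI c.1 c.2) := S.codeFP_startI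
  have h := foldl (σ := δ × ℕ) (α := Unit) (β := StI ι) (eσ := pairE eδ unE) (eα := unitE) (eβ := stE eι)
    (step := fun c _ b => O.giantI c.1 b b) (init := fun c => O.startI c.1 c.2) hstep hinit
    (5 * S.bound + 6 * X + 15)
    (fun c l₁ l₂ => by
      obtain ⟨d, s₀⟩ := c
      rw [foldl_units_eq_iterate]
      have hiter : ∀ j, (fun b => O.giantI d b b)^[j] (O.startI d s₀) = O.dblI d s₀ j := by
        intro j
        induction j with
        | zero => rfl
        | succ j ih => rw [Function.iterate_succ_apply', ih]; rfl
      simp only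
      rw [hiter]
      set L := (pairE (pairE eδ unE) (rawE unitE) ((d, s₀), l₁ ++ l₂)).length with hL
      have hLd : (eδ d).length ≤ L := by simp only [hL, pairE_apply, length_boolPair]; omega
      have hLs : s₀ ≤ L := by simp only [hL, pairE_apply, length_boolPair, length_unE]; omega
      have hLj : l₁.length ≤ L := by
        have := length_le_length_rawE unitE (l₁ ++ l₂)
        simp only [List.length_append] at this
        simp only [hL, pairE_apply, length_boolPair]; omega
      have hB := TM2Iter.eval_mono S.bound hLd
      obtain ⟨hv, hD⟩ := S.valid_dblI d s₀ l₁.length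
      refine (S.length_stE_le hv hD).trans ?_
      have hsz : (2 ^ (l₁.length + 1) * (s₀ + 1)).size ≤ (l₁.length + 1) + (s₀ + 1) := by
        rw [mul_comm]
        refine (size_mul_two_pow_le _ _).trans ?_
        have : (s₀ + 1).size ≤ s₀ + 1 := Nat.size_le.2 Nat.lt_two_pow_self
        omega
      simp only [eval_add, eval_mul, eval_X, eval_ofNat]
      omega)
  have hin : CodeFP (pairE eδ (pairE unE unE)) (pairE (pairE eδ unE) (rawE unitE))
      (fun p => ((p.1, p.2.1), List.replicate p.2.2 ())) :=
    ((fst _ _).pair (snd _ _).fst').pair (replicateUnit.comp (snd _ _).snd')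
  refine ((h.comp hin).congr fun p => ?_)
  simp only [foldl_units_eq_iterate, List.length_replicate]
  have hiter : ∀ j, (fun b => O.giantI p.1 b b)^[j] (O.startI p.1 p.2.1) = O.dblI p.1 p.2.1 j := by
    intro j
    induction j with
    | zero => rfl
    | succ j ih => rw [Function.iterate_succ_apply', ih]; rfl
  exact hiter p.2.2

/-! #### The comparison with the target, the descent round and the descent on codes -/

/-- The target test `D̂ N ≤ v 2ᵖ` is computable from `(d, v, N, D̂)`. [folklore] -/
theorem codeFP_leTarget :
    CodeFP (pairE eδ (pairE intE (pairE natE intE))) bitE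
      (fun p => decide (O.leTarget p.1 p.2.1 p.2.2.1 p.2.2.2)) := by
  have hd : CodeFP (pairE eδ (pairE intE (pairE natE intE))) eδ (fun p => p.1) := fst _ _
  have hv : CodeFP (pairE eδ (pairE intE (pairE natE intE))) intE (fun p => p.2.1) := (snd _ _).fst'
  have hN : CodeFP (pairE eδ (pairE intE (pairE natE intE))) intE (fun p => (p.2.2.1 : ℤ)) :=
    (intOfNat.comp (snd _ _).snd'.fst' :)
  have hD : CodeFP (pairE eδ (pairE intE (pairE natE intE))) intE (fun p => p.2.2.2) := (snd _ _).snd'.snd'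
  have h2p : CodeFP (pairE eδ (pairE intE (pairE natE intE))) intE (fun p => (2 : ℤ) ^ O.prec p.1) :=
    (S.codeFP_twoPowPrec.comp hd :)
  refine ((intLe.comp ((intMul.comp (hD.pair hN)).pair (intMul.comp (hv.pair h2p)))).congr fun p => ?_)
  rfl

/-- The context of the descent: `(d, v, N, 1^{s₀}, 1^T)`. [folklore] -/
abbrev dctxE (eδ : δ → List Bool) : δ × ℤ × ℕ × ℕ × ℕ → List Bool :=
  pairE eδ (pairE intE (pairE natE (pairE unE unE)))

/-- **The descent round is computable**: `((d, v, N, s₀, T), (J, k)) ↦ descRound d v N s₀ (J, k)` (the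
level `I_{k−1}` is recomputed by `codeFP_dblI` with `k − 1 ≤ T` in unary). [cite: Jozsa2003, §9 Thm. 5] -/
theorem codeFP_descRound :
    CodeFP (pairE (dctxE eδ) (pairE (stE eι) natE)) (pairE (stE eι) natE)
      (fun t => O.descRound t.1.1 t.1.2.1 t.1.2.2.1 t.1.2.2.2.1 t.1.2.2.2.2 (t.2.1, t.2.2)) := by
  have hd : CodeFP (pairE (dctxE eδ) (pairE (stE eι) natE)) eδ (fun t => t.1.1) := (fst _ _).fst'
  have hv : CodeFP (pairE (dctxE eδ) (pairE (stE eι) natE)) intE (fun t => t.1.2.1) := (fst _ _).snd'.fst'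
  have hN : CodeFP (pairE (dctxE eδ) (pairE (stE eι) natE)) natE (fun t => t.1.2.2.1) := (fst _ _).snd'.snd'.fst'
  have hs : CodeFP (pairE (dctxE eδ) (pairE (stE eι) natE)) unE (fun t => t.1.2.2.2.1) :=
    (fst _ _).snd'.snd'.snd'.fst'
  have hT : CodeFP (pairE (dctxE eδ) (pairE (stE eι) natE)) unE (fun t => t.1.2.2.2.2) :=
    (fst _ _).snd'.snd'.snd'.snd'
  have hJ : CodeFP (pairE (dctxE eδ) (pairE (stE eι) natE)) (stE eι) (fun t => t.2.1) := (snd _ _).fst'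
  have hk : CodeFP (pairE (dctxE eδ) (pairE (stE eι) natE)) natE (fun t => t.2.2) := (snd _ _).snd'
  have hk1 : CodeFP (pairE (dctxE eδ) (pairE (stE eι) natE)) natE (fun t => t.2.2 - 1) :=
    (natSub.comp (hk.pair (const _ 1)) :)
  -- `k - 1` in unary, capped by `T`
  have hku : CodeFP (pairE (dctxE eδ) (pairE (stE eι) natE)) unE (fun t => min (t.2.2 - 1) t.1.2.2.2.2) :=
    (unOfNatMin.comp (hT.pair hk1) :)
  have hlvl : CodeFP (pairE (dctxE eδ) (pairE (stE eι) natE)) (stE eι)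
      (fun t => O.dblI t.1.1 t.1.2.2.2.1 (min (t.2.2 - 1) t.1.2.2.2.2)) := (S.codeFP_dblI.comp (hd.pair (hs.pair hku)) :)
  have hg : CodeFP (pairE (dctxE eδ) (pairE (stE eι) natE)) (stE eι)
      (fun t => O.giantI t.1.1 t.2.1 (O.dblI t.1.1 t.1.2.2.2.1 (min (t.2.2 - 1) t.1.2.2.2.2))) :=
    (S.codeFP_giantI.comp (hd.pair (hJ.pair hlvl)) :)
  have hc : CodeFP (pairE (dctxE eδ) (pairE (stE eι) natE)) bitE
      (fun t => decide (O.leTarget t.1.1 t.1.2.1 t.1.2.2.1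
        (O.giantI t.1.1 t.2.1 (O.dblI t.1.1 t.1.2.2.2.1 (min (t.2.2 - 1) t.1.2.2.2.2))).2)) :=
    (S.codeFP_leTarget.comp (hd.pair (hv.pair (hN.pair hg.snd'))) :)
  have hstepped : CodeFP (pairE (dctxE eδ) (pairE (stE eι) natE)) (stE eι)
      (fun t => if O.leTarget t.1.1 t.1.2.1 t.1.2.2.1
        (O.giantI t.1.1 t.2.1 (O.dblI t.1.1 t.1.2.2.2.1 (min (t.2.2 - 1) t.1.2.2.2.2))).2 then
        O.giantI t.1.1 t.2.1 (O.dblI t.1.1 t.1.2.2.2.1 (min (t.2.2 - 1) t.1.2.2.2.2)) else t.2.1) :=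
    (hc.ite hg hJ).congr fun t => by
      by_cases h : O.leTarget t.1.1 t.1.2.1 t.1.2.2.1
        (O.giantI t.1.1 t.2.1 (O.dblI t.1.1 t.1.2.2.2.1 (min (t.2.2 - 1) t.1.2.2.2.2))).2 <;> simp [h]
  have hz : CodeFP (pairE (dctxE eδ) (pairE (stE eι) natE)) bitE (fun t => decide (t.2.2 = 0)) :=
    (natEq.comp (hk.pair (const _ 0)) :)
  -- the round, with the level capped at `T` (no cap on a genuine run: `k - 1 < T`)
  refine (((hz.ite (hJ.pair hk) (hstepped.pair hk1))).congr fun t => ?_)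
  unfold descRound
  by_cases h : t.2.2 = 0 <;> simp [h]

/-- **The integer descent is computable**: `(d, v, N, 1^{s₀}, 1^T) ↦ descentFromI d v N s₀ T 0` —
`T` rounds of `descRound` over a unit budget, each recomputing its level (so `O(T²)` giant steps,
all on genuine, valid states). [cite: Jozsa2003, §9 Thm. 5] -/
theorem codeFP_descentI :
    CodeFP (dctxE eδ) (stE eι) (fun c => O.descentFromI c.1 c.2.1 c.2.2.1 c.2.2.2.1 c.2.2.2.2 0) := by
  have hstep : CodeFP (pairE (dctxE eδ) (pairE unitE (pairE (stE eι) natE))) (pairE (stE eι) natE)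
      (fun t => O.descRound t.1.1 t.1.2.1 t.1.2.2.1 t.1.2.2.2.1 t.1.2.2.2.2 (t.2.2.1, t.2.2.2)) :=
    (S.codeFP_descRound.comp ((fst _ _).pair ((snd _ _).snd'.fst'.pair (snd _ _).snd'.snd')) :)
  have hinit : CodeFP (dctxE eδ) (pairE (stE eι) natE) (fun c => ((O.unit c.1, (0 : ℤ)), c.2.2.2.2)) :=
    ((S.h_unit.comp (fst _ _)).pair (const _ (0 : ℤ))).pair (natOfUn.comp (snd _ _).snd'.snd'.snd')
  have h := foldl (σ := δ × ℤ × ℕ × ℕ × ℕ) (α := Unit) (β := StI ι × ℕ) (eσ := dctxE eδ) (eα := unitE)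
    (eβ := pairE (stE eι) natE)
    (step := fun c _ b => O.descRound c.1 c.2.1 c.2.2.1 c.2.2.2.1 c.2.2.2.2 b)
    (init := fun c => ((O.unit c.1, 0), c.2.2.2.2)) hstep hinit
    (2 * (5 * S.bound + 9 * X + 18) + 2 + X)
    (fun c l₁ l₂ => by
      obtain ⟨d, v, N, s₀, T⟩ := c
      rw [foldl_units_eq_iterate]
      simp only
      set L := (pairE (dctxE eδ) (rawE unitE) ((d, v, N, s₀, T), l₁ ++ l₂)).length with hL
      have hLd : (eδ d).length ≤ L := by simp only [hL, pairE_apply, length_boolPair]; omega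
      have hLs : s₀ ≤ L := by simp only [hL, pairE_apply, length_boolPair, length_unE]; omega
      have hLT : T ≤ L := by simp only [hL, pairE_apply, length_boolPair, length_unE]; omega
      have hB := TM2Iter.eval_mono S.bound hLd
      -- the state after `j = |l₁|` rounds: either a genuine partial descent (`j ≤ T`) or frozen
      have hstate : ∀ j, ∃ k, k ≤ T ∧
          (O.descRound d v N s₀ T)^[j] ((O.unit d, 0), T) = (O.descentFromI d v N s₀ T k, k) := by
        intro j
        rcases le_or_gt j T with hj | hj
        · exact ⟨T - j, Nat.sub_le _ _, O.descRound_iterate d v N s₀ T hj⟩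
        · refine ⟨0, Nat.zero_le _, ?_⟩
          have hT := O.descRound_iterate d v N s₀ T (le_refl T)
          rw [Nat.sub_self] at hT
          have hfix : ∀ i, (O.descRound d v N s₀ T)^[T + i] ((O.unit d, 0), T) = (O.descentFromI d v N s₀ T 0, 0) := by
            intro i
            induction i with
            | zero => simpa using hT
            | succ i ih => rw [Nat.add_succ, Function.iterate_succ_apply', ih, descRound, if_pos rfl]
          have := hfix (j - T)
          rwa [Nat.add_sub_cancel' hj.le] at this
      obtain ⟨k, hkT, hk⟩ := hstate l₁.length
      rw [hk]
      obtain ⟨hv, hD⟩ := S.valid_descentFromI d v N s₀ T k hkT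
      have hD' : (O.descentFromI d v N s₀ T k).2.natAbs ≤ (T * (2 ^ T * (s₀ + 1) + 1)) * 2 ^ S.bound.eval (eδ d).length :=
        hD.trans (Nat.mul_le_mul_right _ (Nat.mul_le_mul_right _ (Nat.sub_le _ _)))
      have hst := S.length_stE_le hv hD'
      have hsz : (T * (2 ^ T * (s₀ + 1) + 1)).size ≤ 3 * L + 2 := by
        have h1 : T * (2 ^ T * (s₀ + 1) + 1) ≤ (T * (s₀ + 2)) * 2 ^ T := by
          have : 1 ≤ 2 ^ T := Nat.one_le_two_pow
          nlinarith
        refine (Nat.size_le_size h1).trans ((size_mul_two_pow_le _ _).trans ?_)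
        have h2 := size_mul_le T (s₀ + 2)
        have h3 : T.size ≤ T := Nat.size_le.2 Nat.lt_two_pow_self
        have h4 : (s₀ + 2).size ≤ s₀ + 2 := Nat.size_le.2 Nat.lt_two_pow_self
        omega
      have hk' : (natE k).length ≤ L := (length_natE_le k).trans (hkT.trans hLT)
      simp only [pairE_apply, length_boolPair] at hst
      simp only [pairE_apply, length_boolPair, eval_add, eval_mul, eval_X, eval_ofNat]
      nlinarith)
  have hin : CodeFP (dctxE eδ) (pairE (dctxE eδ) (rawE unitE)) (fun c => (c, List.replicate c.2.2.2.2 ())) :=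
    (CodeFP.id _).pair (replicateUnit.comp (snd _ _).snd'.snd'.snd')
  refine (((h.comp hin).fst').congr fun c => ?_)
  simp only [foldl_units_eq_iterate, List.length_replicate]
  exact O.descRound_iterate_self c.1 c.2.1 c.2.2.1 c.2.2.2.1 c.2.2.2.2

/-! #### The final walk and the table on codes -/

/-- The final round is computable (context `(d, v, N)`). [cite: Jozsa2003, §9 Thm. 5] -/
theorem codeFP_finStepI :
    CodeFP (pairE (pairE eδ (pairE intE natE)) (stE eι)) (stE eι)
      (fun t => O.finStepI t.1.1 t.1.2.1 t.1.2.2 t.2) := by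
  have hd : CodeFP (pairE (pairE eδ (pairE intE natE)) (stE eι)) eδ (fun t => t.1.1) := (fst _ _).fst'
  have hv : CodeFP (pairE (pairE eδ (pairE intE natE)) (stE eι)) intE (fun t => t.1.2.1) := (fst _ _).snd'.fst'
  have hN : CodeFP (pairE (pairE eδ (pairE intE natE)) (stE eι)) natE (fun t => t.1.2.2) := (fst _ _).snd'.snd'
  have hJ : CodeFP (pairE (pairE eδ (pairE intE natE)) (stE eι)) (stE eι) (fun t => t.2) := snd _ _
  have hb : CodeFP (pairE (pairE eδ (pairE intE natE)) (stE eι)) (stE eι) (fun t => O.babyI t.1.1 t.2) :=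
    (S.codeFP_babyI.comp (hd.pair hJ) :)
  have hc : CodeFP (pairE (pairE eδ (pairE intE natE)) (stE eι)) bitE
      (fun t => decide (O.leTarget t.1.1 t.1.2.1 t.1.2.2 (O.babyI t.1.1 t.2).2)) :=
    (S.codeFP_leTarget.comp (hd.pair (hv.pair (hN.pair hb.snd'))) :)
  refine ((hc.ite hb hJ).congr fun t => ?_)
  unfold finStepI
  by_cases h : O.leTarget t.1.1 t.1.2.1 t.1.2.2 (O.babyI t.1.1 t.2).2 <;> simp [h]

/-- The context of the table: `(d, N, v, 1^{s₀}, 1^T, 1^B)`. [folklore] -/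
abbrev tctxE (eδ : δ → List Bool) : δ × ℕ × ℤ × ℕ × ℕ × ℕ → List Bool :=
  pairE eδ (pairE natE (pairE intE (pairE unE (pairE unE unE))))

/-- **The integer walk is computable**: `(d, N, v, 1^{s₀}, 1^T, 1^B) ↦ finalI d v N s₀ T B`.
[cite: Jozsa2003, §9 Thm. 5] -/
theorem codeFP_finalI :
    CodeFP (tctxE eδ) (stE eι) (fun c => O.finalI c.1 c.2.2.1 c.2.1 c.2.2.2.1 c.2.2.2.2.1 c.2.2.2.2.2) := by
  have hd : CodeFP (tctxE eδ) eδ (fun c => c.1) := fst _ _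
  have hN : CodeFP (tctxE eδ) natE (fun c => c.2.1) := (snd _ _).fst'
  have hv : CodeFP (tctxE eδ) intE (fun c => c.2.2.1) := (snd _ _).snd'.fst'
  have hs : CodeFP (tctxE eδ) unE (fun c => c.2.2.2.1) := (snd _ _).snd'.snd'.fst'
  have hT : CodeFP (tctxE eδ) unE (fun c => c.2.2.2.2.1) := (snd _ _).snd'.snd'.snd'.fst'
  have hB : CodeFP (tctxE eδ) unE (fun c => c.2.2.2.2.2) := (snd _ _).snd'.snd'.snd'.snd'
  have hdesc : CodeFP (tctxE eδ) (stE eι)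
      (fun c => O.descentFromI c.1 c.2.2.1 c.2.1 c.2.2.2.1 c.2.2.2.2.1 0) :=
    (S.codeFP_descentI.comp (hd.pair (hv.pair (hN.pair (hs.pair hT)))) :)
  -- the final fold: context = the whole input (so that the initial state, the descent, is genuine)
  have hstep : CodeFP (pairE (tctxE eδ) (pairE unitE (stE eι))) (stE eι)
      (fun t => O.finStepI t.1.1 t.1.2.2.1 t.1.2.1 t.2.2) :=
    (S.codeFP_finStepI.comp (((fst _ _).fst'.pair ((fst _ _).snd'.snd'.fst'.pair (fst _ _).snd'.fst')).pair
      (snd _ _).snd') :)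
  have h := foldl (σ := δ × ℕ × ℤ × ℕ × ℕ × ℕ) (α := Unit) (β := StI ι) (eσ := tctxE eδ) (eα := unitE)
    (eβ := stE eι) (step := fun c _ b => O.finStepI c.1 c.2.2.1 c.2.1 b)
    (init := fun c => O.descentFromI c.1 c.2.2.1 c.2.1 c.2.2.2.1 c.2.2.2.2.1 0) hstep hdesc
    (5 * S.bound + 12 * X + 30)
    (fun c l₁ l₂ => by
      obtain ⟨d, N, v, s₀, T, B⟩ := c
      rw [foldl_units_eq_iterate]
      simp only
      set L := (pairE (tctxE eδ) (rawE unitE) ((d, N, v, s₀, T, B), l₁ ++ l₂)).length with hL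
      have hLd : (eδ d).length ≤ L := by simp only [hL, pairE_apply, length_boolPair]; omega
      have hLs : s₀ ≤ L := by simp only [hL, pairE_apply, length_boolPair, length_unE]; omega
      have hLT : T ≤ L := by simp only [hL, pairE_apply, length_boolPair, length_unE]; omega
      have hLj : l₁.length ≤ L := by
        have := length_le_length_rawE unitE (l₁ ++ l₂)
        simp only [List.length_append] at this
        simp only [hL, pairE_apply, length_boolPair]; omega
      have hB := TM2Iter.eval_mono S.bound hLd
      obtain ⟨hv0, hD0⟩ := S.valid_descentFromI d v N s₀ T 0 (Nat.zero_le T)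
      rw [Nat.sub_zero] at hD0
      obtain ⟨hv, hD⟩ := S.valid_iterate_finStepI d v N _ hv0 _ hD0 l₁.length
      refine (S.length_stE_le hv hD).trans ?_
      have hsz : (T * (2 ^ T * (s₀ + 1) + 1) + l₁.length).size ≤ 4 * L + 3 := by
        have h1 : T * (2 ^ T * (s₀ + 1) + 1) + l₁.length ≤ (T * (s₀ + 2) + l₁.length) * 2 ^ T := by
          have : 1 ≤ 2 ^ T := Nat.one_le_two_pow
          nlinarith
        refine (Nat.size_le_size h1).trans ((size_mul_two_pow_le _ _).trans ?_)
        have h2 := size_add_le (T * (s₀ + 2)) l₁.length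
        have h3 := size_mul_le T (s₀ + 2)
        have h4 : T.size ≤ T := Nat.size_le.2 Nat.lt_two_pow_self
        have h5 : (s₀ + 2).size ≤ s₀ + 2 := Nat.size_le.2 Nat.lt_two_pow_self
        have h6 : l₁.length.size ≤ l₁.length := Nat.size_le.2 Nat.lt_two_pow_self
        have h7 : max (T * (s₀ + 2)).size l₁.length.size ≤ (T * (s₀ + 2)).size + l₁.length.size := max_le (by omega) (by omega)
        omega
      simp only [eval_add, eval_mul, eval_X, eval_ofNat]
      nlinarith)
  have hin : CodeFP (tctxE eδ) (pairE (tctxE eδ) (rawE unitE)) (fun c => (c, List.replicate c.2.2.2.2.2 ())) :=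
    (CodeFP.id _).pair (replicateUnit.comp hB)
  refine (((h.comp hin)).congr fun c => ?_)
  simp only [foldl_units_eq_iterate, List.length_replicate]
  rfl

/-- The scaled ceiling `⌈N D̂/2ᵖ⌉` is computable from `(d, N, D̂)`. [folklore] -/
theorem codeFP_ceilScaled : CodeFP (pairE eδ (pairE natE intE)) intE (fun p => O.ceilScaled p.1 p.2.1 p.2.2) := by
  have hd : CodeFP (pairE eδ (pairE natE intE)) eδ (fun p => p.1) := fst _ _
  have hN : CodeFP (pairE eδ (pairE natE intE)) intE (fun p => (p.2.1 : ℤ)) := (intOfNat.comp (snd _ _).fst' :)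
  have hD : CodeFP (pairE eδ (pairE natE intE)) intE (fun p => p.2.2) := (snd _ _).snd'
  have hnum : CodeFP (pairE eδ (pairE natE intE)) intE (fun p => -((p.2.1 : ℤ) * p.2.2)) :=
    (intNeg.comp (intMul.comp (hN.pair hD)) :)
  exact (intNeg.comp (intEDiv.comp (hnum.pair (S.codeFP_twoPowPrec.comp hd)))).congr fun _ => rfl

/-- **The integer table is computable**: `(d, N, v, 1^{s₀}, 1^T, 1^B) ↦ tableI d N s₀ T B v` —
Hallgren's periodic function evaluated in polynomial time (Jozsa 2003, Thm. 5), given polynomial-time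
primitives on valid labels (`FPSpec`); by `tableI_eq_table` this is the table of the rational walk of
`InfrastructureNavigation.lean`. [cite: Jozsa2003, §9 Thm. 5, §10 Prop. 36 (ii)] -/
theorem codeFP_tableI :
    CodeFP (tctxE eδ) (pairE eι intE) (fun c => O.tableI c.1 c.2.1 c.2.2.2.1 c.2.2.2.2.1 c.2.2.2.2.2 c.2.2.1) := by
  have hd : CodeFP (tctxE eδ) eδ (fun c => c.1) := fst _ _
  have hN : CodeFP (tctxE eδ) natE (fun c => c.2.1) := (snd _ _).fst'
  have hv : CodeFP (tctxE eδ) intE (fun c => c.2.2.1) := (snd _ _).snd'.fst'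
  have hfin := S.codeFP_finalI
  have hlab : CodeFP (tctxE eδ) eι (fun c => (O.finalI c.1 c.2.2.1 c.2.1 c.2.2.2.1 c.2.2.2.2.1 c.2.2.2.2.2).1) := hfin.fst'
  have hD : CodeFP (tctxE eδ) intE (fun c => (O.finalI c.1 c.2.2.1 c.2.1 c.2.2.2.1 c.2.2.2.2.1 c.2.2.2.2.2).2) := hfin.snd'
  have hceil : CodeFP (tctxE eδ) intE
      (fun c => O.ceilScaled c.1 c.2.1 (O.finalI c.1 c.2.2.1 c.2.1 c.2.2.2.1 c.2.2.2.2.1 c.2.2.2.2.2).2) :=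
    (S.codeFP_ceilScaled.comp (hd.pair (hN.pair hD)) :)
  have hoff : CodeFP (tctxE eδ) intE
      (fun c => c.2.2.1 - O.ceilScaled c.1 c.2.1 (O.finalI c.1 c.2.2.1 c.2.1 c.2.2.2.1 c.2.2.2.2.1 c.2.2.2.2.2).2) :=
    (intSub.comp (hv.pair hceil) :)
  exact (hlab.pair hoff).congr fun _ => rfl

end FPSpec

end FP

end IntWalkOps

end Literature.Computability.Cryptography

end
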